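/-
Copyright (c) 2026 the pub-hodgecm-mathlib formalisation cell (harness21).  Prover seat hodgecm-mathlib-F0P3-p03 (g15): road «S3-ram» (LEAD F0P3a-plan (g12); owner
F0P3a-p06 (g15)); F0P3a-p01 (g16)'s junction plan J-PACK (2026-09-01T23:57:42Z), item J4b «LATTICE INTERVALS ARE FINITE» (free hand); 2026-09-02.
-/
import Literature.NumberTheory.Automorphic.UnitaryLatticeTreeTypes                  -- ★ (B-p14 (g35)): `scaleLattice`, `mem_scaleLattice_stdLattice_iff`, `mapGL` calculus (brings `UnitaryLatticeTreeDefs`)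
import Literature.NumberTheory.Automorphic.HeckePairsValuedFiniteResidueField       -- ★ (lit-hodgefound-p11 (g38)): `finite_quotient_integer_span_of_ne_zero` (`𝒪/(d)` finite)
import HarnessLib

/-!
# The lattice graph of a hermitian space — LATTICE INTERVALS ARE FINITE: over a `ℤᵐ⁰`-valued field with a uniformiser and finite residue field, only finitely many
# `𝒪`-submodules `M` of `K^N` satisfy `a·𝒪^N ≤ M ≤ b·𝒪^N` (Serre, *Trees* II.1.1; Shimura 1971 Lemma 3.10)

Topic `NumberTheory/Automorphic`; namespace `Literature.NumberTheory.Automorphic.UnitaryLatticeTree`.  THEOREMS ONLY (no definition, no instance, no notation, no named fact,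
no `sorry`); kernel lane `--supports stmt-HodgeConjecture-24833`; GENERIC (`K` with `Valued K ℤᵐ⁰`, `hϖ : v ϖ = exp (−1)`, `[Finite 𝓀[K]]`; any `N`; no form, no `σ`).
Cell `pub/hodgecm-mathlib` (D-0151), crux H413; road «S3-ram» (Literature seeding, count-neutral).  This is item **J4b** of F0P3a-p01 (g16)'s junction plan «J-PACK» (what
stands between the ★ tree-induction engine `DepthZeroKappaTransferTypeOneRamifiedTreeInduction` (p847302) and the statement-first head of the ramified type-(1) G-side law):
the engine's hypothesis `hFfin : F.Finite` for `F` = the set of vertices fixed by a regular torus element `T` is J4a («fixed vertices are depth-bounded»: `ϖΔ·L₀ ≤ M ≤ Δ⁻¹·L₀`,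
`Δ = Π(λ_i − λ_j)`, F0P3a-p01) + THIS FILE («intervals are finite»).  Also reusable wherever a bounded family of lattices must be counted (A-p19 (g27)'s torsor counts, the
binary fixed balls of A-p12 (g23)).

THE MATHEMATICS.  Let `a, b ∈ K^×` with `|a| ≤ |b|`, so `d := a∕b ∈ 𝒪 ∖ {0}`.  For `x ∈ b·𝒪^N` the coordinates `x_i∕b` are integral; send `x` to their residues in the FINITE
ring `(𝒪∕(d))^N` (`𝒪∕(d)` is finite: `𝒪` is a DVR with finite residue field, `(d) = 𝔪^k` — ★ `finite_quotient_integer_span_of_ne_zero`).  Two vectors of `b·𝒪^N` with the same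
residues differ by an element of `a·𝒪^N` (§1 `sub_mem_scaleLattice_of_residues_eq`).  Hence an `𝒪`-module `M` with `a·𝒪^N ≤ M ≤ b·𝒪^N` is determined by the SET of residue
vectors of its elements (§2 `le_of_residueSet_subset`: if the residue set of `M` is contained in that of `M′ ⊇ a·𝒪^N` then `M ≤ M′`), and there are only finitely many such sets:
**`{M | a·𝒪^N ≤ M ≤ b·𝒪^N}` is finite** (§2 `finite_setOf_scaleLattice_le_and_le`).  §3: the same for the translated interval `g·a𝒪^N ≤ M ≤ g·b𝒪^N`, `g ∈ GL_N(K)`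
(`finite_setOf_mapGL_scaleLattice_le_and_le`, through the injection `M ↦ g⁻¹·M`), and the consumer shapes `F ⊆ interval ⇒ F.Finite`.
HONEST LABEL: HC_CM is proved only modulo the 2 remaining named inputs (hLiu418 24832, h413 24833) until rung 0 closes; nothing printed is asserted here (elementary commutative
algebra); «S3-ram» has no books consequence.

* §1 `v_div_le_one_of_mem_scaleLattice_stdLattice` (coordinates of `b·𝒪^N` over `b` are integral), `sub_mem_scaleLattice_of_residues_eq` (same residues mod `a∕b` ⇒ difference in `a·𝒪^N`).
* §2 `le_of_residueSet_subset`, **`finite_setOf_scaleLattice_le_and_le`**, `finite_of_forall_scaleLattice_le_and_le`.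
* §3 `finite_setOf_mapGL_scaleLattice_le_and_le`, `finite_of_forall_mapGL_scaleLattice_le_and_le`.

## References
* [Serre1980Trees] J.-P. Serre, *Trees* (1980), Ch. II §1.1 (lattices between `ϖⁿL` and `L` ↔ submodules of `L∕ϖⁿL`; finitely many).
* [ShimuraIATAF1971] G. Shimura, *Introduction to the Arithmetic Theory of Automorphic Functions* (1971), §3.2 Lemma 3.10 (finiteness of lattices between two given ones).
* [Serre1979] J.-P. Serre, *Local Fields* (1979), Ch. I §1 Prop. 1 (`𝒪` a DVR: `(d) = 𝔪^k`).
-/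

set_option autoImplicit false

noncomputable section

open scoped Valued WithZero Matrix MatrixGroups

namespace Literature.NumberTheory.Automorphic.UnitaryLatticeTree

open Literature.NumberTheory.Automorphic Literature.NumberTheory.Automorphic.HermitianLattice

variable {K : Type*} [Field K] [Valued K ℤᵐ⁰] {N : ℕ}

/-! ## §1 Residues of the coordinates of `b·𝒪^N` modulo `a∕b` -/

/-- For `x ∈ b·𝒪^N` (`b ≠ 0`) every coordinate `x_i∕b` is integral. [cite: Serre1980Trees, II.1.1] -/
theorem v_div_le_one_of_mem_scaleLattice_stdLattice {b : K} (hb : b ≠ 0) {x : Fin N → K} (hx : x ∈ scaleLattice b (stdLattice K N)) (i : Fin N) :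
    Valued.v (x i / b) ≤ 1 := by
  have hvb : Valued.v b ≠ 0 := (Valuation.ne_zero_iff _).2 hb
  rw [map_div₀, div_le_one₀ (zero_lt_iff.2 hvb)]
  exact (mem_scaleLattice_stdLattice_iff hb x).1 hx i

/-- **Same residues ⇒ difference in `a·𝒪^N`.**  Let `|a| ≤ |b|`, `a ≠ 0`, `d = a∕b ∈ 𝒪`.  If `x, y ∈ b·𝒪^N` have, coordinate by coordinate, the same residue of `x_i∕b` and
`y_i∕b` modulo the ideal `(d)`, then `x − y ∈ a·𝒪^N`. [cite: Serre1980Trees, II.1.1] [cite: ShimuraIATAF1971, §3.2 Lemma 3.10] -/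
theorem sub_mem_scaleLattice_of_residues_eq {a b : K} (ha : a ≠ 0) (hb : b ≠ 0) (hab : Valued.v a ≤ Valued.v b)
    {x y : Fin N → K} (hx : x ∈ scaleLattice b (stdLattice K N)) (hy : y ∈ scaleLattice b (stdLattice K N))
    (hres : ∀ i, Ideal.Quotient.mk (Ideal.span {(⟨a / b, by
        rw [mem_integer_iff', map_div₀, div_le_one₀ (zero_lt_iff.2 ((Valuation.ne_zero_iff _).2 hb))]; exact hab⟩ : 𝒪[K])})
          (⟨x i / b, v_div_le_one_of_mem_scaleLattice_stdLattice hb hx i⟩ : 𝒪[K]) =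
      Ideal.Quotient.mk (Ideal.span {(⟨a / b, by
        rw [mem_integer_iff', map_div₀, div_le_one₀ (zero_lt_iff.2 ((Valuation.ne_zero_iff _).2 hb))]; exact hab⟩ : 𝒪[K])})
          (⟨y i / b, v_div_le_one_of_mem_scaleLattice_stdLattice hb hy i⟩ : 𝒪[K])) :
    x - y ∈ scaleLattice a (stdLattice K N) := by
  rw [mem_scaleLattice_stdLattice_iff ha]
  intro i
  obtain ⟨r, hr⟩ := Ideal.mem_span_singleton'.1 (Ideal.Quotient.eq.1 (hres i))
  -- `x_i/b − y_i/b = r·(a/b)` in `K`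
  have hrK : x i / b - y i / b = (r : K) * (a / b) := by
    have h := congrArg (Subtype.val : 𝒪[K] → K) hr
    simpa using h.symm
  have e : x i - y i = (r : K) * a := by
    have h2 : (x i / b - y i / b) * b = (r : K) * (a / b) * b := by rw [hrK]
    field_simp at h2
    linear_combination h2
  rw [Pi.sub_apply, e, map_mul]
  exact mul_le_of_le_one_left' ((mem_integer_iff' _).1 r.2)

/-! ## §2 A module in the interval is determined by its set of residue vectors; the interval is finite -/

/-- **A module in the interval is recovered from its residue set.**  Let `|a| ≤ |b|`, `a ≠ 0`; for `𝒪`-modules `M ≤ b·𝒪^N` and `M′ ⊇ a·𝒪^N`: if every residue vector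
`(x_i∕b mod (a∕b))_i` of an element `x ∈ M` is the residue vector of some element of `M′ ∩ b·𝒪^N`, then `M ≤ M′`. [cite: Serre1980Trees, II.1.1] [cite: ShimuraIATAF1971, §3.2 Lemma 3.10] -/
theorem le_of_residueSet_subset {a b : K} (ha : a ≠ 0) (hb : b ≠ 0) (hab : Valued.v a ≤ Valued.v b)
    {M M' : Submodule 𝒪[K] (Fin N → K)} (hM : M ≤ scaleLattice b (stdLattice K N)) (hM' : scaleLattice a (stdLattice K N) ≤ M')
    (hsub : (fun x : ↥(scaleLattice b (stdLattice K N)) => fun i : Fin N =>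
        Ideal.Quotient.mk (Ideal.span {(⟨a / b, by
          rw [mem_integer_iff', map_div₀, div_le_one₀ (zero_lt_iff.2 ((Valuation.ne_zero_iff _).2 hb))]; exact hab⟩ : 𝒪[K])})
            (⟨(x : Fin N → K) i / b, v_div_le_one_of_mem_scaleLattice_stdLattice hb x.2 i⟩ : 𝒪[K])) ''
          {x | (x : Fin N → K) ∈ M} ⊆
      (fun x : ↥(scaleLattice b (stdLattice K N)) => fun i : Fin N =>
        Ideal.Quotient.mk (Ideal.span {(⟨a / b, by
          rw [mem_integer_iff', map_div₀, div_le_one₀ (zero_lt_iff.2 ((Valuation.ne_zero_iff _).2 hb))]; exact hab⟩ : 𝒪[K])})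
            (⟨(x : Fin N → K) i / b, v_div_le_one_of_mem_scaleLattice_stdLattice hb x.2 i⟩ : 𝒪[K])) ''
          {x | (x : Fin N → K) ∈ M'}) :
    M ≤ M' := by
  intro x hx
  have hxb : x ∈ scaleLattice b (stdLattice K N) := hM hx
  have hmem := hsub ⟨⟨x, hxb⟩, hx, rfl⟩
  obtain ⟨y, hy, hyx⟩ := hmem
  have hres := fun i => (congrFun hyx i).symm
  have hdiff : x - (y : Fin N → K) ∈ scaleLattice a (stdLattice K N) :=
    sub_mem_scaleLattice_of_residues_eq ha hb hab hxb y.2 hres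
  have := M'.add_mem (hM' hdiff) hy
  rwa [sub_add_cancel] at this

/-- **LATTICE INTERVALS ARE FINITE.**  Over a `ℤᵐ⁰`-valued field with a uniformiser `ϖ` (`|ϖ| = exp(−1)`) and FINITE RESIDUE FIELD: for `a ≠ 0` and `|a| ≤ |b|`, the set of
`𝒪`-submodules `M` of `K^N` with `a·𝒪^N ≤ M ≤ b·𝒪^N` is finite (they inject into the subsets of the finite ring `(𝒪∕(a∕b))^N`). [cite: Serre1980Trees, II.1.1]
[cite: ShimuraIATAF1971, §3.2 Lemma 3.10] [cite: Serre1979, Ch. I §1 Prop. 1] -/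
theorem finite_setOf_scaleLattice_le_and_le [Finite 𝓀[K]] {ϖ : K} (hϖ : Valued.v ϖ = WithZero.exp (-1 : ℤ)) {a b : K} (ha : a ≠ 0) (hab : Valued.v a ≤ Valued.v b) :
    {M : Submodule 𝒪[K] (Fin N → K) | scaleLattice a (stdLattice K N) ≤ M ∧ M ≤ scaleLattice b (stdLattice K N)}.Finite := by
  have hb : b ≠ 0 := by
    rintro rfl
    rw [map_zero, le_zero_iff, Valuation.zero_iff] at hab
    exact ha hab
  have hdint : Valued.v (a / b) ≤ 1 := by
    rw [map_div₀, div_le_one₀ (zero_lt_iff.2 ((Valuation.ne_zero_iff _).2 hb))]; exact hab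
  set d : 𝒪[K] := ⟨a / b, (mem_integer_iff' _).2 hdint⟩ with hd
  have hd0 : d ≠ 0 := by
    intro h0
    have h := congrArg (Subtype.val : 𝒪[K] → K) h0
    simp only [hd, ZeroMemClass.coe_zero, div_eq_zero_iff] at h
    rcases h with h | h
    · exact ha h
    · exact hb h
  haveI : Finite (𝒪[K] ⧸ Ideal.span {d}) := finite_quotient_integer_span_of_ne_zero hϖ hd0
  -- the residue-set map
  let Φ : Submodule 𝒪[K] (Fin N → K) → Set (Fin N → 𝒪[K] ⧸ Ideal.span {d}) := fun M =>
    (fun x : ↥(scaleLattice b (stdLattice K N)) => fun i : Fin N =>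
      Ideal.Quotient.mk (Ideal.span {d}) (⟨(x : Fin N → K) i / b, v_div_le_one_of_mem_scaleLattice_stdLattice hb x.2 i⟩ : 𝒪[K])) '' {x | (x : Fin N → K) ∈ M}
  refine Set.Finite.of_finite_image (f := Φ) (Set.toFinite _) ?_
  rintro M ⟨haM, hMb⟩ M' ⟨haM', hM'b⟩ hΦ
  exact le_antisymm (le_of_residueSet_subset ha hb hab hMb haM' hΦ.le) (le_of_residueSet_subset ha hb hab hM'b haM hΦ.ge)

/-- Consumer shape: a family of `𝒪`-modules all lying in one interval `a·𝒪^N ≤ M ≤ b·𝒪^N` (`a ≠ 0`, `|a| ≤ |b|`) is finite — e.g. the vertices fixed by a regular torus element,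
which lie in `ϖΔ·L₀ ≤ M ≤ Δ⁻¹·L₀` (J4a). [cite: Serre1980Trees, II.1.1] [cite: ShimuraIATAF1971, §3.2 Lemma 3.10] -/
theorem finite_of_forall_scaleLattice_le_and_le [Finite 𝓀[K]] {ϖ : K} (hϖ : Valued.v ϖ = WithZero.exp (-1 : ℤ)) {a b : K} (ha : a ≠ 0) (hab : Valued.v a ≤ Valued.v b)
    {F : Set (Submodule 𝒪[K] (Fin N → K))} (hF : ∀ M ∈ F, scaleLattice a (stdLattice K N) ≤ M ∧ M ≤ scaleLattice b (stdLattice K N)) : F.Finite :=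
  (finite_setOf_scaleLattice_le_and_le hϖ ha hab).subset fun M hM => hF M hM

/-! ## §3 Translated intervals `g·a𝒪^N ≤ M ≤ g·b𝒪^N` -/

/-- **TRANSLATED LATTICE INTERVALS ARE FINITE**: for `g ∈ GL_N(K)`, the `𝒪`-submodules `M` with `g·(a𝒪^N) ≤ M ≤ g·(b𝒪^N)` (`a ≠ 0`, `|a| ≤ |b|`) form a finite set (`M ↦ g⁻¹·M`
is an injection into the interval of §2). [cite: Serre1980Trees, II.1.1] [cite: ShimuraIATAF1971, §3.2 Lemma 3.10] -/
theorem finite_setOf_mapGL_scaleLattice_le_and_le [Finite 𝓀[K]] {ϖ : K} (hϖ : Valued.v ϖ = WithZero.exp (-1 : ℤ)) {a b : K} (ha : a ≠ 0) (hab : Valued.v a ≤ Valued.v b)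
    (g : GL (Fin N) K) :
    {M : Submodule 𝒪[K] (Fin N → K) | mapGL g (scaleLattice a (stdLattice K N)) ≤ M ∧ M ≤ mapGL g (scaleLattice b (stdLattice K N))}.Finite := by
  refine Set.Finite.of_finite_image (f := mapGL g⁻¹) ((finite_setOf_scaleLattice_le_and_le (N := N) hϖ ha hab).subset ?_) (mapGL_injective g⁻¹).injOn
  rintro _ ⟨M, ⟨haM, hMb⟩, rfl⟩
  refine ⟨?_, ?_⟩
  · have h := (mapGL_le_mapGL_iff g⁻¹ _ _).2 haM
    rwa [← mapGL_mul, inv_mul_cancel, mapGL_one] at h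
  · have h := (mapGL_le_mapGL_iff g⁻¹ _ _).2 hMb
    rwa [← mapGL_mul, inv_mul_cancel, mapGL_one] at h

/-- Consumer shape, translated: a family of `𝒪`-modules all lying in one translated interval `g·a𝒪^N ≤ M ≤ g·b𝒪^N` (`a ≠ 0`, `|a| ≤ |b|`) is finite.
[cite: Serre1980Trees, II.1.1] [cite: ShimuraIATAF1971, §3.2 Lemma 3.10] -/
theorem finite_of_forall_mapGL_scaleLattice_le_and_le [Finite 𝓀[K]] {ϖ : K} (hϖ : Valued.v ϖ = WithZero.exp (-1 : ℤ)) {a b : K} (ha : a ≠ 0)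
    (hab : Valued.v a ≤ Valued.v b) (g : GL (Fin N) K)
    {F : Set (Submodule 𝒪[K] (Fin N → K))} (hF : ∀ M ∈ F, mapGL g (scaleLattice a (stdLattice K N)) ≤ M ∧ M ≤ mapGL g (scaleLattice b (stdLattice K N))) :
    F.Finite :=
  (finite_setOf_mapGL_scaleLattice_le_and_le hϖ ha hab g).subset fun M hM => hF M hM

end Literature.NumberTheory.Automorphic.UnitaryLatticeTree

end
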